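import Literature.Topology.FourManifolds.PosDetPath
import Mathlib.Analysis.SpecialFunctions.SmoothTransition
import Mathlib.Analysis.Calculus.MeanValue
import Mathlib.Analysis.Normed.Ring.Units
import Mathlib.Analysis.InnerProductSpace.PiL2
import HarnessLib

/-!
# Orientation-preserving embeddings of the closed disc are isotopic to the inclusion

Topic `Literature/Topology/FourManifolds`. PROVED, for the model space
`ℝⁿ⁺¹ = EuclideanSpace ℝ (Fin (n + 1))`:

* `det_pos_of_norm_sub_one_lt` — a continuous linear map within distance `< 1` of the identity
  has positive determinant (Neumann series along the segment to the identity);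
* `exists_isotopy_closedBall_of_det_pos` — **the disc theorem, local form** (Cerf 1968,
  Appendice §5, Proposition 3 at `π₀`: the space `ℰₙ` of orientation-preserving embeddings
  `Dⁿ → ℝⁿ` is connected; Milnor, *Topology from the differentiable viewpoint*, §6, Lemma 2
  ("isotopic to the identity"); Hirsch, *Differential Topology*, Ch. 8, Thm. 3.1, proof): a `C^∞`
  map `f : ℝⁿ⁺¹ → ℝⁿ⁺¹` which is injective with positive Jacobian determinant on the closed unit
  ball (the ambient form of an orientation-preserving embedding `𝔻ⁿ⁺¹ → ℝⁿ⁺¹`) is joined to the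
  identity by a jointly `C^∞` family `F_t` of such maps, `F_0 = id`, `F_1 = f` on the ball:
  `F_t = c_t + Λ_t ∘ G_t` with `c_t` a path of translations, `Λ_t` the path in `GL⁺` from `1` to
  `Df(0)` (`Literature.Topology.FourManifolds.exists_contDiff_path_of_det_pos`,
  `PosDetPath.lean`: `GL⁺` is connected by smooth arcs), and `G_t` the radial rescaling
  `x ↦ g(μ x)/μ` of `g = Df(0)⁻¹ (f − f 0)` down to a scale at which `g` is `C¹`-close to the
  identity, followed by the straight segment to the identity.

Everything is proved; there are no definitions and no named facts.

## References

* J. Cerf, *Sur les difféomorphismes de la sphère de dimension trois (Γ₄ = 0)*, LNM 53 (1968),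
  Appendice §5, Proposition 3. [CerfDiffeoSphere1968]
* J. Milnor, *Topology from the differentiable viewpoint* (1965), §6. [MilnorTDV1965]
* M. W. Hirsch, *Differential Topology*, GTM 33 (1976), Ch. 8, Thm. 3.1. [HirschDT1976]
-/

open scoped ContDiff Topology
open Set Function Metric Module

noncomputable section

namespace Literature.Topology.FourManifolds

/-- Local notation: `𝔼 n` is the model Euclidean space `EuclideanSpace ℝ (Fin n)`. -/
local notation "𝔼 " n:arg => EuclideanSpace ℝ (Fin n)

variable {n : ℕ}

/-! ### Determinants of continuous linear maps: bookkeeping -/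

section DetBookkeeping

variable {E : Type*} [NormedAddCommGroup E] [NormedSpace ℝ E]

/-- `det (A ∘ B) = det A * det B` for continuous linear maps. [folklore] -/
theorem det_clm_comp (A B : E →L[ℝ] E) :
    LinearMap.det ((A.comp B : E →L[ℝ] E) : E →ₗ[ℝ] E) =
      LinearMap.det (A : E →ₗ[ℝ] E) * LinearMap.det (B : E →ₗ[ℝ] E) :=
  LinearMap.det_comp (A : E →ₗ[ℝ] E) (B : E →ₗ[ℝ] E)

/-- `det 1 = 1` for continuous linear maps. [folklore] -/
theorem det_clm_one : LinearMap.det ((1 : E →L[ℝ] E) : E →ₗ[ℝ] E) = 1 := by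
  rw [show ((1 : E →L[ℝ] E) : E →ₗ[ℝ] E) = LinearMap.id from rfl, LinearMap.det_id]

end DetBookkeeping

/-! ### Maps `C¹`-close to the identity -/

section CloseToOne

variable {E : Type*} [NormedAddCommGroup E] [NormedSpace ℝ E] [FiniteDimensional ℝ E]

/-- Along a continuous path of invertible maps the determinant keeps its sign. [folklore] -/
theorem det_pos_of_isUnit_path {A : ℝ → E →L[ℝ] E} (hA : Continuous A)
    (hu : ∀ u ∈ Icc (0 : ℝ) 1, IsUnit (A u))
    (h0 : 0 < LinearMap.det (A 0 : E →ₗ[ℝ] E)) :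
    0 < LinearMap.det (A 1 : E →ₗ[ℝ] E) := by
  by_contra hneg
  have hcont : ContinuousOn (fun u => LinearMap.det (A u : E →ₗ[ℝ] E)) (Icc 0 1) :=
    (ContinuousLinearMap.continuous_det.comp hA).continuousOn
  have hmem : (0 : ℝ) ∈ Icc (LinearMap.det (A 1 : E →ₗ[ℝ] E)) (LinearMap.det (A 0 : E →ₗ[ℝ] E)) :=
    ⟨not_lt.mp hneg, h0.le⟩
  obtain ⟨r, hr, hr0⟩ := intermediate_value_Icc' zero_le_one hcont hmem
  have hu' := hu r hr
  rw [ContinuousLinearMap.isUnit_iff_isUnit_toLinearMap, LinearMap.isUnit_iff_isUnit_det] at hu'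
  exact hu'.ne_zero hr0

/-- **A continuous linear map within distance `< 1` of the identity has positive determinant**
(the segment to the identity consists of invertible maps, by the Neumann series). [folklore] -/
theorem det_pos_of_norm_sub_one_lt [CompleteSpace E] {A : E →L[ℝ] E} (h : ‖A - 1‖ < 1) :
    0 < LinearMap.det (A : E →ₗ[ℝ] E) := by
  have key := det_pos_of_isUnit_path (A := fun u : ℝ => 1 + u • (A - 1))
    (continuous_const.add (continuous_id.smul continuous_const)) (fun u hu => ?_) ?_
  · have heq : (1 : E →L[ℝ] E) + (1 : ℝ) • (A - 1) = A := by module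
    have key' : 0 < LinearMap.det (((1 : E →L[ℝ] E) + (1 : ℝ) • (A - 1) : E →L[ℝ] E) :
        E →ₗ[ℝ] E) := key
    rwa [heq] at key'
  · have hN : ‖-(u • (A - 1))‖ < 1 := by
      rw [norm_neg, norm_smul, Real.norm_of_nonneg hu.1]
      calc u * ‖A - 1‖ ≤ 1 * ‖A - 1‖ := by gcongr; exact hu.2
        _ < 1 := by rw [one_mul]; exact h
    have h1 : IsUnit ((1 : E →L[ℝ] E) - -(u • (A - 1))) := (Units.oneSub (-(u • (A - 1))) hN).isUnit
    rwa [sub_neg_eq_add] at h1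
  · have heq : (1 : E →L[ℝ] E) + (0 : ℝ) • (A - 1) = 1 := by module
    show 0 < LinearMap.det (((1 : E →L[ℝ] E) + (0 : ℝ) • (A - 1) : E →L[ℝ] E) : E →ₗ[ℝ] E)
    rw [heq, det_clm_one]
    exact one_pos

end CloseToOne

/-! ### The disc theorem, local form -/

/-- **Orientation-preserving embeddings of the closed disc are isotopic to the inclusion
through embeddings** (ambient form). Let `f : ℝⁿ⁺¹ → ℝⁿ⁺¹` be `C^∞`, injective on the closed
unit ball with Jacobian determinant positive there. Then there is a jointly `C^∞` family
`F_t : ℝⁿ⁺¹ → ℝⁿ⁺¹` with `F_0 = id`, `F_1 = f`, every `F_t` injective on the closed unit ball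
with positive Jacobian determinant there. This is the connectedness of Cerf's space
`ℰ_{n+1} = Pl⁺(Dⁿ⁺¹, ℝⁿ⁺¹)` (Appendice §5, Proposition 3, which proves more: `ℰₙ ≃ SO(n)`),
proved as in Milnor, *Topology from the differentiable viewpoint*, §6 (translate, rescale
radially towards the differential at the centre, straighten by a segment once `C¹`-close to the
identity, and join the differential to the identity inside `GL⁺`,
`exists_contDiff_path_of_det_pos`); the stages are composed rather than concatenated, so the
family is given by one formula
`F_t x = ρ(t) f(0) + Λ_t (G_{1-t} x)`, `G_τ x = (1 - σ τ) g(μ_τ x)/μ_τ + σ(τ) x`.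
[cite: CerfDiffeoSphere1968, Appendice §5, Proposition 3]
[cite: MilnorTDV1965, §6, Lemma 2 (pp. 33–34)] -/
theorem exists_isotopy_closedBall_of_det_pos {f : 𝔼 (n + 1) → 𝔼 (n + 1)} (hf : ContDiff ℝ ∞ f)
    (hinj : InjOn f (closedBall 0 1))
    (hdet : ∀ x ∈ closedBall (0 : 𝔼 (n + 1)) 1,
      0 < LinearMap.det (fderiv ℝ f x : 𝔼 (n + 1) →ₗ[ℝ] 𝔼 (n + 1))) :
    ∃ F : ℝ → 𝔼 (n + 1) → 𝔼 (n + 1), ContDiff ℝ ∞ (uncurry F) ∧ (∀ x, F 0 x = x) ∧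
      (∀ x, F 1 x = f x) ∧ (∀ t, InjOn (F t) (closedBall 0 1)) ∧
      ∀ t, ∀ x ∈ closedBall (0 : 𝔼 (n + 1)) 1,
        0 < LinearMap.det (fderiv ℝ (F t) x : 𝔼 (n + 1) →ₗ[ℝ] 𝔼 (n + 1)) := by
  have hfd : ∀ x, HasFDerivAt f (fderiv ℝ f x) x := fun x =>
    (hf.differentiable (by simp) x).hasFDerivAt
  -- the differential at the centre and its inverse
  set c : 𝔼 (n + 1) := f 0 with hc
  set L : 𝔼 (n + 1) →L[ℝ] 𝔼 (n + 1) := fderiv ℝ f 0 with hL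
  have hLdet : 0 < LinearMap.det (L : 𝔼 (n + 1) →ₗ[ℝ] 𝔼 (n + 1)) := hdet 0 (by simp)
  have hLu : IsUnit L := by
    rw [ContinuousLinearMap.isUnit_iff_isUnit_toLinearMap, LinearMap.isUnit_iff_isUnit_det]
    exact isUnit_iff_ne_zero.mpr hLdet.ne'
  obtain ⟨uL, huL⟩ := hLu
  set Linv : 𝔼 (n + 1) →L[ℝ] 𝔼 (n + 1) := ((uL⁻¹ : (𝔼 (n + 1) →L[ℝ] 𝔼 (n + 1))ˣ) :
    𝔼 (n + 1) →L[ℝ] 𝔼 (n + 1)) with hLinv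
  have hLinvL : Linv.comp L = 1 := by
    rw [hLinv, ← huL, ← ContinuousLinearMap.mul_def, Units.inv_mul]
  have hLLinv : L.comp Linv = 1 := by
    rw [hLinv, ← huL, ← ContinuousLinearMap.mul_def, Units.mul_inv]
  have hLinvL' : ∀ x, Linv (L x) = x := fun x => by
    rw [← ContinuousLinearMap.comp_apply, hLinvL]; rfl
  have hLLinv' : ∀ x, L (Linv x) = x := fun x => by
    rw [← ContinuousLinearMap.comp_apply, hLLinv]; rfl
  have hLinvdet : 0 < LinearMap.det (Linv : 𝔼 (n + 1) →ₗ[ℝ] 𝔼 (n + 1)) := by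
    have h := congrArg (fun A : 𝔼 (n + 1) →L[ℝ] 𝔼 (n + 1) =>
      LinearMap.det (A : 𝔼 (n + 1) →ₗ[ℝ] 𝔼 (n + 1))) hLinvL
    simp only [det_clm_comp, det_clm_one] at h
    have h1 : 0 < LinearMap.det (Linv : 𝔼 (n + 1) →ₗ[ℝ] 𝔼 (n + 1)) *
        LinearMap.det (L : 𝔼 (n + 1) →ₗ[ℝ] 𝔼 (n + 1)) := by rw [h]; exact one_pos
    exact (pos_iff_pos_of_mul_pos h1).mpr hLdet
  -- the normalised map `g = L⁻¹ (f - c)`: `g 0 = 0`, `Dg(0) = 1`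
  obtain ⟨g, hg_def⟩ : ∃ g : 𝔼 (n + 1) → 𝔼 (n + 1), g = fun x => Linv (f x - c) := ⟨_, rfl⟩
  have hg : ContDiff ℝ ∞ g := by rw [hg_def]; exact Linv.contDiff.comp (hf.sub contDiff_const)
  have hgd : ∀ x, HasFDerivAt g (Linv.comp (fderiv ℝ f x)) x := fun x => by
    rw [hg_def]; exact Linv.hasFDerivAt.comp x ((hfd x).sub_const c)
  have hgd' : ∀ x, fderiv ℝ g x = Linv.comp (fderiv ℝ f x) := fun x => (hgd x).fderiv
  have hgd0 : fderiv ℝ g 0 = 1 := by rw [hgd' 0]; exact hLinvL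
  have hgdet : ∀ y ∈ closedBall (0 : 𝔼 (n + 1)) 1,
      0 < LinearMap.det (fderiv ℝ g y : 𝔼 (n + 1) →ₗ[ℝ] 𝔼 (n + 1)) := fun y hy => by
    rw [hgd' y, det_clm_comp]; exact mul_pos hLinvdet (hdet y hy)
  have hginj : InjOn g (closedBall 0 1) := fun x hx y hy hxy => by
    rw [hg_def] at hxy
    have h1 : f x - c = f y - c := by
      have := congrArg L hxy
      simp only [hLLinv'] at this
      exact this
    exact hinj hx hy (sub_left_injective h1)
  have hfg : ∀ x, f x = c + L (g x) := fun x => by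
    rw [hg_def]; simp only [hLLinv']; abel
  -- the scale `ε` at which `g` is `C¹`-close to the identity
  obtain ⟨ε, hε, hε1, hclose⟩ : ∃ ε : ℝ, 0 < ε ∧ ε ≤ 1 ∧
      ∀ y : 𝔼 (n + 1), ‖y‖ ≤ ε → ‖fderiv ℝ g y - 1‖ ≤ 1 / 2 := by
    have hcont : ContinuousAt (fderiv ℝ g) 0 := (hg.continuous_fderiv (by simp)).continuousAt
    rw [Metric.continuousAt_iff] at hcont
    obtain ⟨δ, hδ, hδ'⟩ := hcont (1 / 2) (by norm_num)
    refine ⟨min (δ / 2) 1, lt_min (half_pos hδ) one_pos, min_le_right _ _, fun y hy => ?_⟩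
    have hy' : dist y 0 < δ := by
      rw [dist_zero_right]
      exact lt_of_le_of_lt (hy.trans (min_le_left _ _)) (half_lt_self hδ)
    have := hδ' hy'
    rw [dist_eq_norm, hgd0] at this
    exact this.le
  -- time profiles: `μ` from `1` down to `ε` on `[0, 1/2]`, then `σ` from `0` to `1` on `[1/2, 1]`
  obtain ⟨μ, hμ_def⟩ : ∃ μ : ℝ → ℝ, μ = fun t => 1 - (1 - ε) * Real.smoothTransition (2 * t) :=
    ⟨_, rfl⟩
  obtain ⟨σ, hσ_def⟩ : ∃ σ : ℝ → ℝ, σ = fun t => Real.smoothTransition (2 * t - 1) := ⟨_, rfl⟩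
  have hμs : ContDiff ℝ ∞ μ := by
    rw [hμ_def]
    exact contDiff_const.sub (contDiff_const.mul
      (Real.smoothTransition.contDiff.comp (contDiff_const.mul contDiff_id)))
  have hσs : ContDiff ℝ ∞ σ := by
    rw [hσ_def]
    exact Real.smoothTransition.contDiff.comp ((contDiff_const.mul contDiff_id).sub contDiff_const)
  have hμI : ∀ t, ε ≤ μ t ∧ μ t ≤ 1 := fun t => by
    rw [hμ_def]
    have h0 := Real.smoothTransition.nonneg (2 * t)
    have h1 := Real.smoothTransition.le_one (2 * t)
    constructor <;> nlinarith
  have hμpos : ∀ t, 0 < μ t := fun t => hε.trans_le (hμI t).1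
  have hμ0 : ∀ t ≤ (0 : ℝ), μ t = 1 := fun t ht => by
    rw [hμ_def]
    simp only [Real.smoothTransition.zero_of_nonpos (by linarith : 2 * t ≤ 0), mul_zero, sub_zero]
  have hμ1 : ∀ t, 1 / 2 ≤ t → μ t = ε := fun t ht => by
    rw [hμ_def]
    simp only [Real.smoothTransition.one_of_one_le (by linarith : 1 ≤ 2 * t), mul_one,
      sub_sub_cancel]
  have hσI : ∀ t, 0 ≤ σ t ∧ σ t ≤ 1 := fun t => by
    rw [hσ_def]; exact ⟨Real.smoothTransition.nonneg _, Real.smoothTransition.le_one _⟩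
  have hσ0 : ∀ t ≤ (1 / 2 : ℝ), σ t = 0 := fun t ht => by
    rw [hσ_def]; exact Real.smoothTransition.zero_of_nonpos (by linarith)
  have hσ1 : ∀ t, 1 ≤ t → σ t = 1 := fun t ht => by
    rw [hσ_def]; exact Real.smoothTransition.one_of_one_le (by linarith)
  -- the family `G_t = (1 - σ t) (μ t)⁻¹ g (μ t ·) + σ t · id` from `g` to `id`
  obtain ⟨G, hG_def⟩ : ∃ G : ℝ → 𝔼 (n + 1) → 𝔼 (n + 1),
      G = fun t x => (1 - σ t) • (μ t)⁻¹ • g (μ t • x) + σ t • x := ⟨_, rfl⟩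
  have hGs : ContDiff ℝ ∞ (uncurry G) := by
    rw [hG_def]
    have hμ' : ContDiff ℝ ∞ fun p : ℝ × 𝔼 (n + 1) => μ p.1 := hμs.comp contDiff_fst
    have hσ' : ContDiff ℝ ∞ fun p : ℝ × 𝔼 (n + 1) => σ p.1 := hσs.comp contDiff_fst
    exact ((contDiff_const.sub hσ').smul ((hμ'.inv fun p => (hμpos p.1).ne').smul
      (hg.comp (hμ'.smul contDiff_snd)))).add (hσ'.smul contDiff_snd)
  have hG_apply : ∀ t x, G t x = (1 - σ t) • (μ t)⁻¹ • g (μ t • x) + σ t • x := fun t x => by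
    rw [hG_def]
  have hG0 : ∀ x, G 0 x = g x := fun x => by
    rw [hG_apply, hσ0 0 (by norm_num), hμ0 0 le_rfl]; simp
  have hG1 : ∀ x, G 1 x = x := fun x => by
    rw [hG_apply, hσ1 1 le_rfl]; simp
  -- derivative of the stages
  have hGd : ∀ t x, HasFDerivAt (G t)
      ((1 - σ t) • fderiv ℝ g (μ t • x) + σ t • (1 : 𝔼 (n + 1) →L[ℝ] 𝔼 (n + 1))) x := by
    intro t x
    have h1 : HasFDerivAt (fun y : 𝔼 (n + 1) => μ t • y)
        (μ t • (1 : 𝔼 (n + 1) →L[ℝ] 𝔼 (n + 1))) x := (hasFDerivAt_id x).const_smul (μ t)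
    have h2 : HasFDerivAt (fun y : 𝔼 (n + 1) => g (μ t • y))
        ((fderiv ℝ g (μ t • x)).comp (μ t • (1 : 𝔼 (n + 1) →L[ℝ] 𝔼 (n + 1)))) x :=
      ((hgd (μ t • x)).differentiableAt.hasFDerivAt).comp x h1
    have h3 : HasFDerivAt (fun y : 𝔼 (n + 1) => (μ t)⁻¹ • g (μ t • y))
        (fderiv ℝ g (μ t • x)) x := by
      refine (h2.const_smul (μ t)⁻¹).congr_fderiv (ContinuousLinearMap.ext fun v => ?_)
      show (μ t)⁻¹ • fderiv ℝ g (μ t • x) ((μ t • (1 : 𝔼 (n + 1) →L[ℝ] 𝔼 (n + 1))) v) =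
        fderiv ℝ g (μ t • x) v
      rw [show (μ t • (1 : 𝔼 (n + 1) →L[ℝ] 𝔼 (n + 1))) v = μ t • v from rfl, map_smul, smul_smul,
        inv_mul_cancel₀ (hμpos t).ne', one_smul]
    have h4 := ((h3.const_smul (1 - σ t)).add ((hasFDerivAt_id x).const_smul (σ t)))
    refine h4.congr_of_eventuallyEq (Filter.Eventually.of_forall fun y => ?_)
    rw [hG_apply]; rfl
  have hGd' : ∀ t x, fderiv ℝ (G t) x =
      (1 - σ t) • fderiv ℝ g (μ t • x) + σ t • (1 : 𝔼 (n + 1) →L[ℝ] 𝔼 (n + 1)) :=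
    fun t x => (hGd t x).fderiv
  -- positivity of the Jacobian determinant of the stages on the ball
  have hGdet : ∀ t, ∀ x ∈ closedBall (0 : 𝔼 (n + 1)) 1,
      0 < LinearMap.det (fderiv ℝ (G t) x : 𝔼 (n + 1) →ₗ[ℝ] 𝔼 (n + 1)) := by
    intro t x hx
    have hx1 : ‖x‖ ≤ 1 := mem_closedBall_zero_iff.mp hx
    rw [hGd']
    by_cases ht : t ≤ 1 / 2
    · -- radial phase: `σ t = 0`, the derivative is `Dg(μ t • x)` with `μ t • x` in the ball
      rw [hσ0 t ht]
      have heq : (1 - (0 : ℝ)) • fderiv ℝ g (μ t • x) + (0 : ℝ) • (1 : 𝔼 (n + 1) →L[ℝ] 𝔼 (n + 1)) =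
          fderiv ℝ g (μ t • x) := by module
      rw [heq]
      refine hgdet _ (mem_closedBall_zero_iff.mpr ?_)
      rw [norm_smul, Real.norm_of_nonneg (hμpos t).le]
      calc μ t * ‖x‖ ≤ 1 * 1 := mul_le_mul (hμI t).2 hx1 (norm_nonneg _) zero_le_one
        _ = 1 := one_mul 1
    · -- straightening phase: `μ t = ε`, the derivative is within `1/2` of the identity
      have hμt : μ t = ε := hμ1 t (by linarith)
      rw [hμt]
      apply det_pos_of_norm_sub_one_lt
      have heq : (1 - σ t) • fderiv ℝ g (ε • x) + σ t • (1 : 𝔼 (n + 1) →L[ℝ] 𝔼 (n + 1)) - 1 =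
          (1 - σ t) • (fderiv ℝ g (ε • x) - 1) := by module
      rw [heq, norm_smul, Real.norm_of_nonneg (by linarith [(hσI t).2])]
      have hb := hclose (ε • x) (by
        rw [norm_smul, Real.norm_of_nonneg hε.le]
        calc ε * ‖x‖ ≤ ε * 1 := by gcongr
          _ = ε := mul_one ε)
      calc (1 - σ t) * ‖fderiv ℝ g (ε • x) - 1‖ ≤ 1 * (1 / 2) := by
            gcongr
            · linarith [(hσI t).1]
        _ < 1 := by norm_num
  -- injectivity of the stages on the ball
  have hGinj : ∀ t, InjOn (G t) (closedBall 0 1) := by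
    intro t x hx y hy hxy
    have hx1 : ‖x‖ ≤ 1 := mem_closedBall_zero_iff.mp hx
    have hy1 : ‖y‖ ≤ 1 := mem_closedBall_zero_iff.mp hy
    rw [hG_apply, hG_apply] at hxy
    by_cases ht : t ≤ 1 / 2
    · -- radial phase
      rw [hσ0 t ht] at hxy
      have e1 : ∀ z : 𝔼 (n + 1), (1 - (0 : ℝ)) • (μ t)⁻¹ • g (μ t • z) + (0 : ℝ) • z =
          (μ t)⁻¹ • g (μ t • z) := fun z => by module
      rw [e1, e1] at hxy
      have h1 : g (μ t • x) = g (μ t • y) := smul_right_injective _ (inv_ne_zero (hμpos t).ne') hxy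
      have hmem : ∀ z : 𝔼 (n + 1), ‖z‖ ≤ 1 → μ t • z ∈ closedBall (0 : 𝔼 (n + 1)) 1 := by
        intro z hz
        rw [mem_closedBall_zero_iff, norm_smul, Real.norm_of_nonneg (hμpos t).le]
        calc μ t * ‖z‖ ≤ 1 * 1 := mul_le_mul (hμI t).2 hz (norm_nonneg _) zero_le_one
          _ = 1 := one_mul 1
      exact smul_right_injective _ (hμpos t).ne' (hginj (hmem x hx1) (hmem y hy1) h1)
    · -- straightening phase: `id + (1 - σ t) k` with `k` a `1/2`-contraction
      have hμt : μ t = ε := hμ1 t (by linarith)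
      rw [hμt] at hxy
      obtain ⟨k, hk⟩ : ∃ k : 𝔼 (n + 1) → 𝔼 (n + 1), k = fun z => ε⁻¹ • g (ε • z) - z := ⟨_, rfl⟩
      have hkd : ∀ z, HasFDerivAt k (fderiv ℝ g (ε • z) - 1) z := by
        intro z
        have h1 : HasFDerivAt (fun w : 𝔼 (n + 1) => ε • w)
            (ε • (1 : 𝔼 (n + 1) →L[ℝ] 𝔼 (n + 1))) z := (hasFDerivAt_id z).const_smul ε
        have h2 : HasFDerivAt (fun w : 𝔼 (n + 1) => g (ε • w))
            ((fderiv ℝ g (ε • z)).comp (ε • (1 : 𝔼 (n + 1) →L[ℝ] 𝔼 (n + 1)))) z :=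
          ((hgd (ε • z)).differentiableAt.hasFDerivAt).comp z h1
        have h3 : HasFDerivAt (fun w : 𝔼 (n + 1) => ε⁻¹ • g (ε • w)) (fderiv ℝ g (ε • z)) z := by
          refine (h2.const_smul ε⁻¹).congr_fderiv (ContinuousLinearMap.ext fun v => ?_)
          show ε⁻¹ • fderiv ℝ g (ε • z) ((ε • (1 : 𝔼 (n + 1) →L[ℝ] 𝔼 (n + 1))) v) =
            fderiv ℝ g (ε • z) v
          rw [show (ε • (1 : 𝔼 (n + 1) →L[ℝ] 𝔼 (n + 1))) v = ε • v from rfl, map_smul, smul_smul,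
            inv_mul_cancel₀ hε.ne', one_smul]
        rw [hk]
        exact h3.sub (hasFDerivAt_id z)
      have hkb : ∀ z ∈ closedBall (0 : 𝔼 (n + 1)) 1, ‖fderiv ℝ k z‖ ≤ 1 / 2 := by
        intro z hz
        rw [(hkd z).fderiv]
        refine hclose (ε • z) ?_
        rw [norm_smul, Real.norm_of_nonneg hε.le]
        calc ε * ‖z‖ ≤ ε * 1 := by gcongr; exact mem_closedBall_zero_iff.mp hz
          _ = ε := mul_one ε
      have hlip : ‖k y - k x‖ ≤ 1 / 2 * ‖y - x‖ :=
        (convex_closedBall (0 : 𝔼 (n + 1)) 1).norm_image_sub_le_of_norm_fderiv_le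
          (fun z _ => (hkd z).differentiableAt) hkb hx hy
      -- `x + (1 - σ) k x = y + (1 - σ) k y`
      have hk_apply : ∀ z, k z = ε⁻¹ • g (ε • z) - z := fun z => by rw [hk]
      have ex : ∀ z : 𝔼 (n + 1), (1 - σ t) • ε⁻¹ • g (ε • z) + σ t • z = z + (1 - σ t) • k z := by
        intro z
        rw [hk_apply, smul_sub]
        module
      rw [ex, ex] at hxy
      have hxy' : x - y = (1 - σ t) • (k y - k x) := by
        have h1 : x = y + (1 - σ t) • k y - (1 - σ t) • k x := eq_sub_of_add_eq hxy
        rw [smul_sub]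
        nth_rewrite 1 [h1]
        abel
      have hnorm : ‖x - y‖ ≤ 1 / 2 * ‖x - y‖ := by
        calc ‖x - y‖ = ‖(1 - σ t) • (k y - k x)‖ := by rw [hxy']
          _ = (1 - σ t) * ‖k y - k x‖ := by
              rw [norm_smul, Real.norm_of_nonneg (by linarith [(hσI t).2])]
          _ ≤ 1 * (1 / 2 * ‖y - x‖) :=
              mul_le_mul (by linarith [(hσI t).1]) hlip (norm_nonneg _) zero_le_one
          _ = 1 / 2 * ‖x - y‖ := by rw [one_mul, norm_sub_rev]
      have h0 : ‖x - y‖ ≤ 0 := by linarith [hnorm, norm_nonneg (x - y)]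
      exact sub_eq_zero.mp (norm_le_zero_iff.mp h0)
  -- the path `Λ` in `GL⁺` from `1` to `L` (`PosDetPath.lean`, reversed), and the assembly
  obtain ⟨Λ, hΛs, hΛ0, hΛ1, hΛdet⟩ : ∃ Λ : ℝ → (𝔼 (n + 1) →L[ℝ] 𝔼 (n + 1)), ContDiff ℝ ∞ Λ ∧
      Λ 0 = 1 ∧ Λ 1 = L ∧ ∀ t, 0 < LinearMap.det (Λ t : 𝔼 (n + 1) →ₗ[ℝ] 𝔼 (n + 1)) := by
    set Le : 𝔼 (n + 1) ≃L[ℝ] 𝔼 (n + 1) := ContinuousLinearEquiv.unitsEquiv ℝ (𝔼 (n + 1)) uL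
      with hLe
    have hLe' : (Le : 𝔼 (n + 1) →L[ℝ] 𝔼 (n + 1)) = L := by
      rw [← huL]; exact ContinuousLinearMap.ext fun x => rfl
    obtain ⟨γ, hγs, hγ0, hγ1, hγdet⟩ := exists_contDiff_path_of_det_pos Le (by rw [hLe']; exact hLdet)
    refine ⟨fun t => γ (1 - t), hγs.comp (contDiff_const.sub contDiff_id), ?_, ?_, fun t => hγdet _⟩
    · show γ (1 - 0) = 1
      rw [sub_zero, hγ1]
    · show γ (1 - 1) = L
      rw [sub_self, hγ0, hLe']
  set ρ : ℝ → ℝ := Real.smoothTransition with hρ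
  refine ⟨fun t x => ρ t • c + Λ t (G (1 - t) x), ?_, fun x => ?_, fun x => ?_, fun t => ?_,
    fun t x hx => ?_⟩
  · -- joint smoothness
    have hG' : ContDiff ℝ ∞ fun p : ℝ × 𝔼 (n + 1) => G (1 - p.1) p.2 :=
      hGs.comp ((contDiff_const.sub contDiff_fst).prodMk contDiff_snd)
    exact ((Real.smoothTransition.contDiff.comp contDiff_fst).smul contDiff_const).add
      ((hΛs.comp contDiff_fst).clm_apply hG')
  · show ρ 0 • c + Λ 0 (G (1 - 0) x) = x
    rw [hρ, Real.smoothTransition.zero, zero_smul, zero_add, hΛ0, sub_zero, hG1]; rfl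
  · show ρ 1 • c + Λ 1 (G (1 - 1) x) = f x
    rw [hρ, Real.smoothTransition.one, one_smul, hΛ1, sub_self, hG0, hfg]
  · intro x hx y hy hxy
    have h1 : Λ t (G (1 - t) x) = Λ t (G (1 - t) y) := add_left_cancel hxy
    have hΛu : IsUnit (Λ t) := by
      rw [ContinuousLinearMap.isUnit_iff_isUnit_toLinearMap, LinearMap.isUnit_iff_isUnit_det]
      exact isUnit_iff_ne_zero.mpr (hΛdet t).ne'
    have hΛinj : Injective (Λ t) := (ContinuousLinearMap.isUnit_iff_bijective.mp hΛu).1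
    exact hGinj (1 - t) hx hy (hΛinj h1)
  · have hd : HasFDerivAt (fun x => ρ t • c + Λ t (G (1 - t) x))
        ((Λ t).comp (fderiv ℝ (G (1 - t)) x)) x :=
      ((Λ t).hasFDerivAt.comp x (hGd (1 - t) x).differentiableAt.hasFDerivAt).const_add (ρ t • c)
    rw [hd.fderiv, det_clm_comp]
    exact mul_pos (hΛdet t) (hGdet (1 - t) x hx)

end Literature.Topology.FourManifolds
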